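import Summits.CriticalPhenomena.PercolationContinuityZ3.Theorems.Transplant.SitePeel
import Summits.CriticalPhenomena.PercolationContinuityZ3.Theorems.Transplant.SiteSurplusClosure
import Summits.CriticalPhenomena.PercolationContinuityZ3.Theorems.SiteTransplantThm6Skeleton
import HarnessLib

/-!
# SITE percolation: `SiteCSHAll ⇒ SiteSurplusTransfer ⇒ SiteAdditiveGluing ⇒ SiteNearOneGluing` — degenerate observers
# and the final assembly of the site finite leg above the conditioned slack hierarchy
# (lane `prim-bschramm`, class C1a; site twin of `Theorems/PercNearOneGluingAdditiveGluingS5Assembly.lean` + `…CSHToS5.lean`)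

builds on p205010 (kernel theorem, internal audit signed; external expert review pending).

The site peeling theorem (`SiteCSH.s5dMargin_nonneg_of_siteCSH`, file `SitePeel`) gives (S5)_site for NON-DEGENERATE vertex
weights and observers `o ∉ T`, `o ≠ v`; the closure `SiteCSH.siteSurplusTransfer_of_nondegenerate` (file `SiteSurplusClosure`)
removes the non-degeneracy.  The two degenerate observer positions differ from bond in one point — `{o ↔ o} = {o open}` is NOT
the sure event for site percolation — and are settled here by the NONNEGATIVITY OF THE SITE SURPLUS `Sur_u(T) ≥ 0` for every
observer `u`, which is literally (GEN)_site (`SiteGen.siteGen_of_siteSurplusTransfer`) for the relay set `T`, available inside a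
strong induction on `|T|` ((GEN)_site for `|A| ≤ N` needs (S5)_site only for `|T| ≤ N − 1`):
* `o = v`:  `μ(v ↮ T, v open)·Sur_v(T) ≤ μ(v ↮ T)·Sur_v(T)` by monotonicity of `μ` and `Sur_v(T) ≥ 0`;
* `o ∈ T`:  the left event is empty, the right side is `≥ 0` by `Sur_o(T) ≥ 0`.
Results: **`siteSurplusTransfer_of_siteCSHAll : SiteCSHAll → SiteGen.SiteSurplusTransfer`**, and the corollaries
`siteAGloc_of_siteCSHAll`, **`siteAdditiveGluing_of_siteCSHAll`**, `siteNearOneGluing_of_siteCSHAll` (site Conjecture 3),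
`sitePercolationContinuityZ3_of_siteCSHAll` (with the two site ℤ³ inputs of the Thm-6 skeleton).  So the SITE finite leg is
kernel-checked from the site conditioned slack hierarchy `SiteCSHAll` upward; `SiteCSHAll` itself (site Lemma T + (B0)–(B3)) is
the remaining re-typing.
Support file (`--supports stmt-CriticalPhenomena-4575 --as helper`); no definitions, no named facts, no sorries.
[cite: KozmaNitzan2024, Conj. 1 (p. 3), Conj. 3 (p. 15), Conj. 4 (p. 32)]
-/

noncomputable section

namespace Summit.CriticalPhenomena.PercolationContinuityZ3.Theorems.Transplant

namespace SiteCSH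

open MeasureTheory Set
open Literature.Probability.LatticeModels (prodBernoulli)
open Literature.Probability.Percolation
open Summit.CriticalPhenomena.PercolationContinuityZ3.Theorems.SiteTransplant (siteConn mem_siteConn SiteAdditiveGluing
  SiteNearOneGluing SiteAGloc SiteSlabPercolation SiteBGN sitePercolationContinuityZ3_of)
open SiteGen (mem_siteConn_iff_mem_siteCluster siteConn_comm SiteSurplusTransfer siteGen_of_siteSurplusTransfer)
open scoped Classical

/-- **`SiteCSHAll ⇒ (S5)_site` at every vertex-weight function and every observer position.**  Strong induction on `|T|`:
the surplus of every observer is nonnegative by (GEN)_site for `T` (from (S5)_site for smaller relay sets), which settles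
`o = v` and `o ∈ T`; the generic position is the peeling theorem closed over degenerate weights.
[cite: KozmaNitzan2024, Conj. 4 (p. 32)] -/
theorem siteSurplusTransfer_of_siteCSHAll (h : SiteCSHAll) : SiteSurplusTransfer := by
  have main : ∀ (N n : ℕ) (Γ : SimpleGraph (Fin n)) (q : Fin n → unitInterval) (T : Finset (Fin n)) (o v : Fin n)
      (F : Set (Fin n) → ℝ) (r : Fin n → ℕ), T.card = N →
      v ∉ T → (∀ S S' : Set (Fin n), S ⊆ S' → F S ≤ F S') → (∀ S, 0 ≤ F S) → Set.InjOn r ↑T →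
      (∀ a ∈ T, ∀ a' ∈ T, r a < r a' →
        ∫ ω, F (siteCluster Γ ω a) ∂(prodBernoulli q) ≤ ∫ ω, F (siteCluster Γ ω a') ∂(prodBernoulli q)) →
      (prodBernoulli q).real ({ω : Set (Fin n) | ∀ a ∈ T, a ∉ siteCluster Γ ω v} ∩ siteConn Γ o v) *
          surplus Γ q T r F v ≤
        (prodBernoulli q).real {ω : Set (Fin n) | ∀ a ∈ T, a ∉ siteCluster Γ ω v} * surplus Γ q T r F o := by
    intro N
    induction N using Nat.strong_induction_on with
    | _ N ih =>
    intro n Γ q T o v F r hN hvT hF hF0 hr hcompat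
    set μ := prodBernoulli q with hμ
    -- the site surplus of every observer is nonnegative: (GEN)_site for `T`, from (S5)_site for `|T'| < N`
    have hSur : ∀ u : Fin n, 0 ≤ surplus Γ q T r F u := by
      intro u
      rcases Nat.eq_zero_or_pos N with h0 | hpos
      · subst h0
        have hT : T = ∅ := Finset.card_eq_zero.1 hN
        subst hT
        simp [surplus]
      · obtain ⟨K, hK⟩ : ∃ K, N = K + 1 := ⟨N - 1, by omega⟩
        have hGen := siteGen_of_siteSurplusTransfer K
          (fun n' Γ' q' T' o' v' F' r' hT' hv' hF' hF0' hr' hc' =>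
            ih T'.card (by omega) n' Γ' q' T' o' v' F' r' rfl hv' hF' hF0' hr' hc')
          n Γ q T u F r (by omega) hF hF0 hr hcompat
        have e : surplus Γ q T r F u =
            (∫ ω in (⋃ a ∈ T, siteConn Γ u a), F (siteCluster Γ ω u) ∂μ) -
              ∑ a ∈ T, μ.real (siteConn Γ u a ∩ ⋂ a' ∈ T.filter (fun a' => r a' < r a), (siteConn Γ u a')ᶜ :
                Set (Set (Fin n))) * ∫ ω, F (siteCluster Γ ω a) ∂μ := rfl
        rw [e]
        linarith [hGen]
    by_cases hov : o = v
    · subst hov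
      have hle : μ.real ({ω : Set (Fin n) | ∀ a ∈ T, a ∉ siteCluster Γ ω o} ∩ siteConn Γ o o) ≤
          μ.real {ω : Set (Fin n) | ∀ a ∈ T, a ∉ siteCluster Γ ω o} := measureReal_mono inter_subset_left
      exact mul_le_mul_of_nonneg_right hle (hSur o)
    by_cases hoT : o ∈ T
    · have hempty : ({ω : Set (Fin n) | ∀ a ∈ T, a ∉ siteCluster Γ ω v} ∩ siteConn Γ o v) = ∅ := by
        refine eq_empty_of_forall_notMem fun ω hω => ?_
        have h2 : ω ∈ siteConn Γ v o := by rw [siteConn_comm Γ v o]; exact hω.2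
        exact hω.1 o hoT ((mem_siteConn_iff_mem_siteCluster Γ v o ω).1 h2)
      rw [hempty, measureReal_empty, zero_mul]
      exact mul_nonneg measureReal_nonneg (hSur o)
    · exact siteSurplusTransfer_of_nondegenerate T o v F
        (fun p hp r' hr' hc' => siteSurplusTransfer_nondegenerate_of_siteCSHAll h Γ p hp T o v F r' hoT hvT hov hF hr' hc')
        q r hr hcompat
  intro n Γ q T o v F r hvT hF hF0 hr hcompat
  exact main T.card n Γ q T o v F r rfl hvT hF hF0 hr hcompat

/-- **`SiteCSHAll ⇒ (AG-loc)_site`.** [cite: KozmaNitzan2024, Conj. 4 (p. 32), Question 5 (p. 32)] -/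
theorem siteAGloc_of_siteCSHAll (h : SiteCSHAll) : SiteAGloc :=
  SiteGen.siteAGloc_of_siteSurplusTransfer (siteSurplusTransfer_of_siteCSHAll h)

/-- **`SiteCSHAll ⇒ SiteAdditiveGluing`** — the SITE twin of the crux `PercNearOneGluing.AdditiveGluing` from the site
conditioned slack hierarchy (site twin of `CSH.additiveGluing_of_csh`). [cite: KozmaNitzan2024, Conj. 1 (p. 3), Conj. 4 (p. 32)] -/
theorem siteAdditiveGluing_of_siteCSHAll (h : SiteCSHAll) : SiteAdditiveGluing :=
  SiteGen.siteAdditiveGluing_of_siteSurplusTransfer (siteSurplusTransfer_of_siteCSHAll h)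

/-- **`SiteCSHAll ⇒ SiteNearOneGluing`** (site Conjecture 3, `δ = ε/2`). [cite: KozmaNitzan2024, Conj. 3 (p. 15)] -/
theorem siteNearOneGluing_of_siteCSHAll (h : SiteCSHAll) : SiteNearOneGluing :=
  SiteGen.siteNearOneGluing_of_siteSurplusTransfer (siteSurplusTransfer_of_siteCSHAll h)

/-- **Site `θ_{ℤ³}(p_c^site) = 0` from the site conditioned slack hierarchy and the two site ℤ³ inputs of the Thm-6 skeleton**
(`SiteSlabPercolation`, `SiteBGN`; cf. `SiteTransplant.sitePercolationContinuityZ3_of`). [cite: KozmaNitzan2024, Thm. 6 with Conj. 3 (p. 15)] -/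
theorem sitePercolationContinuityZ3_of_siteCSHAll (hslab : SiteSlabPercolation) (hBGN : SiteBGN) (h : SiteCSHAll) :
    SitePercolationContinuityZ3 :=
  sitePercolationContinuityZ3_of hslab hBGN (siteAGloc_of_siteCSHAll h)

end SiteCSH

end Summit.CriticalPhenomena.PercolationContinuityZ3.Theorems.Transplant
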